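import Literature.NumberTheory.EllipticCurves.PAdicMeasureTransformWeightTwist
import Literature.NumberTheory.EllipticCurves.PAdicLFunctionMinusMultFunctionalEquationProofs
import Literature.NumberTheory.EllipticCurves.PAdicLFunctionMinusMultGammaTwist
import HarnessLib

/-!
# Convergence and functional equation of the `ψ`-TWISTED odd branches `L⁻_p(f, a_p, ω^i ψ, T)` of the
# one-term measure at a prime `p ‖ N` (Mazur–Tate–Teitelbaum 1986, §I.13, §I.17), for quadratic `ψ`

Topic `NumberTheory/EllipticCurves`. Theorems only (no definition, no named fact; D-0014/D-0026).
Companion of `PAdicLFunctionMinusMultFunctionalEquationProofs` (the untwisted odd branches, `ψ = 1`) for the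
objects of `PAdicLFunctionMinusMultGammaTwist`: `padicLMinusBranchMultTwistRiemannSum f α i ε k n =
∑_ζ ζ^i ∑_s εˢ μ⁻(ζγˢ) (s choose k)`, their limits `padicLMinusBranchMultTwistCoeff` and the power series
`padicLFunctionMinusBranchMultTwist f α i ε` — the branch of the character `ω^i ψ` of `ℤ_p^× = Δ × Γ` with
`ψ(γ) = ε` (`ε^{p^j} = 1`). At `p = 2`, `i = 1`, `ε = −1` (`ψ = χ₂`), `α = a₂ = 1`, this is the branch
carrying the cyclotomic Iwasawa theory of the ADDITIVE curve `E'' ⊗ χ_{−2}` for `E''` split multiplicative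
at `2` (cell `bsd-2adic`, the `(−2)`-split-twist block of C4″ 22618).

The twisted Riemann sums are, from level `n ≥ j` on, the PLAIN Riemann sums of the distribution
`ν = (ω^i ψ)·μ⁻ = weightTwist (j+e₀) (ω(·)^i ψ(⟨·⟩)) μ⁻` of `PAdicMeasureTransformWeightTwist`
(`padicLMinusBranchMultTwistRiemannSum_eq`); hence they CONVERGE
(`tendsto_padicLMinusBranchMultTwistRiemannSum`, via the tree's `tendsto_riemannSum_of_distribution`) and
the coefficients are bounded (`norm_padicLMinusBranchMultTwistCoeff_le`). For a QUADRATIC `ψ` (`ε² = 1`) the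
weight `ω(x)^i ψ(⟨x⟩)` transforms under the involution `x ↦ −1/(Mx)` by the constant `ω(−M)^i ψ(⟨M⟩)`
(`teichWeight_eq_mul_of_mul_mul_eq_neg_one`, `psiWeight_eq_mul_of_mul_mul_eq_neg_one`; `τ ∣ 2i`), so the
measure-generic engine `subst_eq_of_measure_symmetry` (modulus `K = M`; fed with `ν` set to `0` below level
`j + e₀`, where the product formula `weightTwist_apply_of_distribution` is not available — the engine needs no
distribution relation) gives the functional equation

  **`L⁻_p(f, a_p, ω^i ψ, ι(T)) = σ ω(−M)^i ψ(⟨M⟩) · (1+T)^c · L⁻_p(f, a_p, ω^i ψ, T)`**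
  (`subst_padicLFunctionMinusBranchMultTwist_eq_of_atkinLehner`; `w_M f = −σ f`, `⟨M⟩ = γ^c`,
  `ψ(⟨M⟩) = ε^{c mod p^j}`),

and `exists_subst_padicLFunctionMinusBranchMultTwist_eq` packages the sign as `w = ±1 ∈ ℤ` with the exponent
produced. (At odd `p`, `ε^{p^j} = 1 ∧ ε² = 1` forces `ε = 1`; the content is at `p = 2`, `ε = −1`.)

## References
* B. Mazur, J. Tate, J. Teitelbaum, *On `p`-adic analogues of the conjectures of Birch and
  Swinnerton-Dyer*, Invent. Math. 84 (1986), 1–48: §I.11–§I.13 (measures, branches), §I.17 (functional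
  equation). [MazurTateTeitelbaum1986Invent]
* R. Greenberg, *Iwasawa theory for elliptic curves*, LNM 1716 (1999), §1 pp. 67–68 (twists by characters of
  `Γ`; `⟨·⟩ = γ^c`). [GreenbergLNM1716]
* A. W. Knapp, *Elliptic curves* (1993), Thm. 9.27(b). [Knapp1993]
-/

noncomputable section

open scoped MatrixGroups ModularForm

open Filter Topology PowerSeries CongruenceSubgroup Literature.NumberTheory.EllipticCurves.ModularForms

namespace Literature.NumberTheory.EllipticCurves

/-! ### The weight `ω(·)^i ψ(⟨·⟩)` -/

section Weight

variable (p : ℕ) [Fact p.Prime]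

/-- `‖ω(u)^i ψ(⟨u⟩)‖ ≤ 1` for `‖ε‖ ≤ 1`. [cite: MazurTateTeitelbaum1986Invent, §I.13] -/
theorem norm_teichWeight_mul_psiWeight_le_one (i j : ℕ) {ε : ℚ_[p]} (hε : ‖ε‖ ≤ 1)
    (u : ZMod (p ^ (j + cyclotomicExponent p))) :
    ‖teichWeight p i (ZMod.castHom (pow_dvd_pow p (Nat.le_add_left (cyclotomicExponent p) j))
        (ZMod (p ^ cyclotomicExponent p)) u) * psiWeight p j ε u‖ ≤ 1 := by
  rw [norm_mul]
  calc _ ≤ 1 * 1 := mul_le_mul (norm_teichWeight_le_one p i _) (norm_psiWeight_le_one p hε u)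
        (norm_nonneg _) zero_le_one
    _ = 1 := mul_one 1

/-- **The weight `ω(·)^i ψ(⟨·⟩)` along the involution `x ↦ −1/(Kx)`** (self-dual `i`, `τ ∣ 2i`;
quadratic `ψ`, `ε^{p^j} = 1`, `ε² = 1`): if `K u u' = −1` modulo `p^{j+e₀}` then
`ω(u)^i ψ(⟨u⟩) = (ω(−K)^i ψ(⟨K⟩)) · ω(u')^i ψ(⟨u'⟩)`. [cite: MazurTateTeitelbaum1986Invent, §I.13 and §I.17] -/
theorem teichWeight_mul_psiWeight_eq_mul {i j : ℕ} (hi : torsionOrder p ∣ 2 * i) {ε : ℚ_[p]}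
    (hε : ε ^ p ^ j = 1) (hε2 : ε ^ 2 = 1) {K u u' : ZMod (p ^ (j + cyclotomicExponent p))}
    (h : K * u * u' = -1) :
    teichWeight p i (ZMod.castHom (pow_dvd_pow p (Nat.le_add_left (cyclotomicExponent p) j))
        (ZMod (p ^ cyclotomicExponent p)) u) * psiWeight p j ε u =
      (teichWeight p i (-(ZMod.castHom (pow_dvd_pow p (Nat.le_add_left (cyclotomicExponent p) j))
          (ZMod (p ^ cyclotomicExponent p)) K)) * psiWeight p j ε K) *
        (teichWeight p i (ZMod.castHom (pow_dvd_pow p (Nat.le_add_left (cyclotomicExponent p) j))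
          (ZMod (p ^ cyclotomicExponent p)) u') * psiWeight p j ε u') := by
  have h' : ZMod.castHom (pow_dvd_pow p (Nat.le_add_left (cyclotomicExponent p) j))
        (ZMod (p ^ cyclotomicExponent p)) K *
      ZMod.castHom (pow_dvd_pow p (Nat.le_add_left (cyclotomicExponent p) j))
        (ZMod (p ^ cyclotomicExponent p)) u *
      ZMod.castHom (pow_dvd_pow p (Nat.le_add_left (cyclotomicExponent p) j))
        (ZMod (p ^ cyclotomicExponent p)) u' = -1 := by
    have := congrArg (ZMod.castHom (pow_dvd_pow p (Nat.le_add_left (cyclotomicExponent p) j))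
      (ZMod (p ^ cyclotomicExponent p))) h
    simpa only [map_mul, map_neg, map_one] using this
  rw [teichWeight_eq_mul_of_mul_mul_eq_neg_one p hi h', psiWeight_eq_mul_of_mul_mul_eq_neg_one p hε hε2 h]
  ring

end Weight

/-! ### The twisted Riemann sums are the plain Riemann sums of the twisted family; convergence -/

section Sums

variable {p : ℕ} [Fact p.Prime] {N : ℕ} (f : CuspForm (Gamma0 N) 2) (α : ℚ_[p])

/-- **From level `n ≥ j` on, the `ω^i ψ`-twisted Riemann sums of `μ⁻_{f,α}` ARE the plain Riemann sums of
the twisted family `(ω^i ψ)·μ⁻ = weightTwist (j + e₀) (ω(·)^i ψ(⟨·⟩)) μ⁻`** (granted the distribution law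
of `μ⁻` and `ε^{p^j} = 1`): on the class `ζγˢ mod p^{n+e₀}` the family is `μ⁻(ζγˢ) ω(ζγˢ)^i ψ(⟨ζγˢ⟩) =
μ⁻(ζγˢ) ζ^i εˢ` (`weightTwist_apply_of_distribution`, `teichWeight_classMap`, `psiWeight_castHom_classMap`).
[cite: MazurTateTeitelbaum1986Invent, §I.13] -/
theorem padicLMinusBranchMultTwistRiemannSum_eq
    (hdist : ∀ (n : ℕ) (a : ZMod (p ^ n)),
      ∑ b ∈ Finset.univ.filter (fun b : ZMod (p ^ (n + 1)) ↦
        ZMod.castHom (pow_dvd_pow p n.le_succ) (ZMod (p ^ n)) b = a),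
          msdMinusMeasureMult f α (n + 1) b = msdMinusMeasureMult f α n a)
    (i : ℕ) {j : ℕ} {ε : ℚ_[p]} (hε : ε ^ p ^ j = 1) (k : ℕ) {n : ℕ} (hn : j ≤ n) :
    padicLMinusBranchMultTwistRiemannSum f α i ε k n =
      ∑ᶠ ζ : rootsOfUnity (torsionOrder p) ℤ_[p], ∑ s : ZMod (p ^ n),
        weightTwist (j + cyclotomicExponent p)
            (fun u ↦ teichWeight p i (ZMod.castHom (pow_dvd_pow p (Nat.le_add_left (cyclotomicExponent p) j))
              (ZMod (p ^ cyclotomicExponent p)) u) * psiWeight p j ε u)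
            (msdMinusMeasureMult f α) (n + cyclotomicExponent p)
            (PadicInt.toZModPow (n + cyclotomicExponent p) ((ζ : ℤ_[p]ˣ) : ℤ_[p]) *
              (cyclotomicGenerator p : ZMod (p ^ (n + cyclotomicExponent p))) ^ s.val) *
          ((s.val.choose k : ℕ) : ℚ_[p]) := by
  have hm : j + cyclotomicExponent p ≤ n + cyclotomicExponent p := Nat.add_le_add_right hn _
  unfold padicLMinusBranchMultTwistRiemannSum
  refine finsum_congr fun ζ ↦ Finset.sum_congr rfl fun s _ ↦ ?_
  rw [weightTwist_apply_of_distribution hdist hm]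
  simp only [castHom_castHom_zmod, teichWeight_classMap p i n ζ s, psiWeight_castHom_classMap p hε hn ζ s]
  ring

/-- **The `ω^i ψ`-twisted Riemann sums of `μ⁻_{f,α}` CONVERGE** to `padicLMinusBranchMultTwistCoeff f α i ε k`,
granted the distribution law and a bound of `μ⁻_{f,α}`, `‖ε‖ ≤ 1` and `ε^{p^j} = 1`: from level `j` on they are
the Riemann sums of the bounded distribution `(ω^i ψ)·μ⁻` (`padicLMinusBranchMultTwistRiemannSum_eq`,
`weightTwist_distribution`, `norm_weightTwist_le`), which converge (`tendsto_riemannSum_of_distribution`), and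
`limUnder` only sees the tail. [cite: MazurTateTeitelbaum1986Invent, §I.11–§I.13] -/
theorem tendsto_padicLMinusBranchMultTwistRiemannSum
    (hdist : ∀ (n : ℕ) (a : ZMod (p ^ n)),
      ∑ b ∈ Finset.univ.filter (fun b : ZMod (p ^ (n + 1)) ↦
        ZMod.castHom (pow_dvd_pow p n.le_succ) (ZMod (p ^ n)) b = a),
          msdMinusMeasureMult f α (n + 1) b = msdMinusMeasureMult f α n a)
    {C : ℝ} (hC : ∀ (n : ℕ) (a : ZMod (p ^ n)), ‖msdMinusMeasureMult f α n a‖ ≤ C) (i : ℕ) {j : ℕ}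
    {ε : ℚ_[p]} (hε1 : ‖ε‖ ≤ 1) (hε : ε ^ p ^ j = 1) (k : ℕ) :
    Tendsto (padicLMinusBranchMultTwistRiemannSum f α i ε k) atTop
      (𝓝 (padicLMinusBranchMultTwistCoeff f α i ε k)) := by
  -- the twisted family and its plain Riemann sums
  set ν : (n : ℕ) → ZMod (p ^ n) → ℚ_[p] := weightTwist (j + cyclotomicExponent p)
    (fun u ↦ teichWeight p i (ZMod.castHom (pow_dvd_pow p (Nat.le_add_left (cyclotomicExponent p) j))
      (ZMod (p ^ cyclotomicExponent p)) u) * psiWeight p j ε u) (msdMinusMeasureMult f α) with hν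
  set RS' : ℕ → ℕ → ℚ_[p] := fun k n ↦
    ∑ᶠ ζ : rootsOfUnity (torsionOrder p) ℤ_[p], ∑ s : ZMod (p ^ n),
      ν (n + cyclotomicExponent p)
          (PadicInt.toZModPow (n + cyclotomicExponent p) ((ζ : ℤ_[p]ˣ) : ℤ_[p]) *
            (cyclotomicGenerator p : ZMod (p ^ (n + cyclotomicExponent p))) ^ s.val) *
        ((s.val.choose k : ℕ) : ℚ_[p]) with hRS'
  have hνdist := weightTwist_distribution (d := j + cyclotomicExponent p)
    (w := fun u ↦ teichWeight p i (ZMod.castHom (pow_dvd_pow p (Nat.le_add_left (cyclotomicExponent p) j))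
      (ZMod (p ^ cyclotomicExponent p)) u) * psiWeight p j ε u) hdist
  have hνbd : ∀ (n : ℕ) (a : ZMod (p ^ n)), ‖ν n a‖ ≤ C := fun n a ↦
    norm_weightTwist_le hC (norm_teichWeight_mul_psiWeight_le_one p i j hε1) n a
  have ht : Tendsto (fun n ↦ RS' k n) atTop (𝓝 (limUnder atTop fun n ↦ RS' k n)) :=
    tendsto_riemannSum_of_distribution (μ := ν) (RS := RS') (fun _ _ ↦ rfl) hνdist hνbd k
  -- the twisted Riemann sums agree with `RS' k` from level `j` on
  have hev : (padicLMinusBranchMultTwistRiemannSum f α i ε k) =ᶠ[atTop] (fun n ↦ RS' k n) :=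
    eventually_atTop.2 ⟨j, fun n hn ↦ padicLMinusBranchMultTwistRiemannSum_eq f α hdist i hε k hn⟩
  have hlim : padicLMinusBranchMultTwistCoeff f α i ε k = limUnder atTop fun n ↦ RS' k n := by
    rw [padicLMinusBranchMultTwistCoeff, limUnder, limUnder, Filter.map_congr hev]
  rw [hlim]
  exact ht.congr' hev.symm

/-- **`‖[Tᵏ] L⁻_p(f, α, ω^i ψ, T)‖ ≤ C`** if `μ⁻_{f,α}` is a distribution bounded by `C`, `‖ε‖ ≤ 1`, `ε^{p^j} = 1`
(the limit of sums of norm `≤ C`). [cite: MazurTateTeitelbaum1986Invent, §I.12–§I.13] -/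
theorem norm_padicLMinusBranchMultTwistCoeff_le
    (hdist : ∀ (n : ℕ) (a : ZMod (p ^ n)),
      ∑ b ∈ Finset.univ.filter (fun b : ZMod (p ^ (n + 1)) ↦
        ZMod.castHom (pow_dvd_pow p n.le_succ) (ZMod (p ^ n)) b = a),
          msdMinusMeasureMult f α (n + 1) b = msdMinusMeasureMult f α n a)
    {C : ℝ} (hC : ∀ (n : ℕ) (a : ZMod (p ^ n)), ‖msdMinusMeasureMult f α n a‖ ≤ C) (i : ℕ) {j : ℕ}
    {ε : ℚ_[p]} (hε1 : ‖ε‖ ≤ 1) (hε : ε ^ p ^ j = 1) (k : ℕ) :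
    ‖padicLMinusBranchMultTwistCoeff f α i ε k‖ ≤ C := by
  classical
  haveI := neZero_torsionOrder p
  haveI := Fintype.ofFinite (rootsOfUnity (torsionOrder p) ℤ_[p])
  have hC0 : 0 ≤ C := (norm_nonneg _).trans (hC 0 0)
  refine le_of_tendsto (tendsto_padicLMinusBranchMultTwistRiemannSum f α hdist hC i hε1 hε k).norm
    (eventually_atTop.2 ⟨j, fun n hn ↦ ?_⟩)
  rw [padicLMinusBranchMultTwistRiemannSum_eq f α hdist i hε k hn, finsum_eq_sum_of_fintype]
  refine IsUltrametricDist.norm_sum_le_of_forall_le_of_nonneg hC0 fun ζ _ ↦ ?_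
  refine IsUltrametricDist.norm_sum_le_of_forall_le_of_nonneg hC0 fun s _ ↦ ?_
  rw [norm_mul]
  refine (mul_le_mul (norm_weightTwist_le hC (norm_teichWeight_mul_psiWeight_le_one p i j hε1) _ _) ?_
    (norm_nonneg _) hC0).trans (le_of_eq (mul_one C))
  simpa using Padic.norm_int_le_one (p := p) ((s.val.choose k : ℕ) : ℤ)

end Sums

/-! ### The functional equation of the `ω^i ψ`-branches at `p ‖ N` -/

section Main

variable {N : ℕ} [NeZero N] {f : CuspForm (Gamma0 N) 2} {p : ℕ} [Fact p.Prime]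

/-- **Functional equation of the `ψ`-twisted self-dual odd branches at a prime `p ‖ N`** (Mazur–Tate–
Teitelbaum 1986, §I.17). Let `f ∈ S₂(Γ₀(N))` be a newform with rational coefficients, `N = pM` with `p ∤ M`,
`a_p(f) = a_p ∈ {±1}`, `w_M f = −σ f` (`σ = ±1`), `⟨M⟩ = γ^c` (`hc`), `τ ∣ 2i`, and `ψ` the character of
`Γ` with `ψ(γ) = ε`, `ε^{p^j} = 1`, `ε² = 1` (quadratic). Then for every `ι` with `(1 + T)(1 + ι) = 1`:
`L⁻_p(f, a_p, ω^i ψ, ι(T)) = σ ω(−M)^i ψ(⟨M⟩) · (1+T)^c · L⁻_p(f, a_p, ω^i ψ, T)`, with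
`ω(−M)^i = teichWeight p i (−M)`, `ψ(⟨M⟩) = psiWeight p j ε M`, `(1+T)^c = PowerSeries.binomialSeries ℚ_[p] c`.
Proof: the measure-generic engine `subst_eq_of_measure_symmetry` (modulus `K = M`) applied to the twisted
family `(ω^i ψ)·μ⁻` truncated to `0` below level `j + e₀` (its Riemann sums still converge to the
coefficients, `tendsto_padicLMinusBranchMultTwistRiemannSum`; it is `σ ω(−M)^i ψ(⟨M⟩)`-symmetric by
`weightTwist_apply_of_distribution`, `msdMinusMeasureMult_eq_mul_of_atkinLehner`, `teichWeight_mul_psiWeight_eq_mul`).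
[cite: MazurTateTeitelbaum1986Invent, §I.17] [cite: GreenbergLNM1716, §1 (pp. 67–68)] -/
theorem subst_padicLFunctionMinusBranchMultTwist_eq_of_atkinLehner {M : ℕ} [NeZero M]
    (hf : IsNewform0 f) (hQ : coeffField f = ⊥) (hNM : N = p * M) (hpM : ¬ p ∣ M)
    {ap : ℤ} (hap : cuspCoeff f p = ap) (hap1 : ap ^ 2 = 1)
    {σ : ℤ} (hσ : σ ^ 2 = 1) (hW : atkinLehnerInvolution N 2 M f = (-(σ : ℂ)) • f)
    {ηM : rootsOfUnity (torsionOrder p) ℤ_[p]} {c : ℤ_[p]}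
    (hc : ∀ n : ℕ, PadicInt.toZModPow (n + cyclotomicExponent p) ((ηM : ℤ_[p]ˣ) : ℤ_[p]) *
        (cyclotomicGenerator p : ZMod (p ^ (n + cyclotomicExponent p))) ^ (PadicInt.toZModPow n c).val =
          (M : ZMod (p ^ (n + cyclotomicExponent p))))
    {i : ℕ} (hi : torsionOrder p ∣ 2 * i) {j : ℕ} {ε : ℚ_[p]} (hε : ε ^ p ^ j = 1) (hε2 : ε ^ 2 = 1)
    {ι : ℚ_[p]⟦X⟧} (hι : (1 + X : ℚ_[p]⟦X⟧) * (ι + 1) = 1) :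
    PowerSeries.subst ι (padicLFunctionMinusBranchMultTwist f (ap : ℚ_[p]) i ε) =
      C ((σ : ℚ_[p]) * (teichWeight p i (-(M : ZMod (p ^ cyclotomicExponent p))) *
          psiWeight p j ε (M : ZMod (p ^ (j + cyclotomicExponent p))))) *
        PowerSeries.binomialSeries ℚ_[p] c * padicLFunctionMinusBranchMultTwist f (ap : ℚ_[p]) i ε := by
  -- the inputs: distribution law, bound of `μ⁻`, `‖ε‖ = 1`
  have hpN : p ∣ N := ⟨M, hNM⟩
  have hap' : ap = 1 ∨ ap = -1 := mul_self_eq_one_iff.mp (by rw [← sq]; exact hap1)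
  have hapn : ‖((ap : ℤ) : ℚ_[p])‖ = 1 := by
    rcases hap' with rfl | rfl
    · simp
    · simp
  have hap0 : ((ap : ℤ) : ℚ_[p]) ≠ 0 := fun h0 ↦ by rw [h0, norm_zero] at hapn; exact zero_ne_one hapn
  have hdist := sum_fiber_msdMinusMeasureMult_succ_eq_of_coeffField (p := p) hf hQ hpN hap hap0
  obtain ⟨C₀, hC₀⟩ := exists_norm_msdMinusMeasureMult_le (f := f) hapn
  have hC00 : 0 ≤ C₀ := (norm_nonneg _).trans (hC₀ 0 0)
  have hε1 : ‖ε‖ ≤ 1 := by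
    have h2 : ‖ε‖ ^ 2 = 1 := by rw [← norm_pow, hε2, norm_one]
    nlinarith [norm_nonneg ε]
  -- the twisted family, truncated to `0` below level `j + e₀`
  set w : ZMod (p ^ (j + cyclotomicExponent p)) → ℚ_[p] := fun u ↦
    teichWeight p i (ZMod.castHom (pow_dvd_pow p (Nat.le_add_left (cyclotomicExponent p) j))
      (ZMod (p ^ cyclotomicExponent p)) u) * psiWeight p j ε u with hw
  set ν : (n : ℕ) → ZMod (p ^ n) → ℚ_[p] := fun m u ↦
    if j + cyclotomicExponent p ≤ m then
      weightTwist (j + cyclotomicExponent p) w (msdMinusMeasureMult f (ap : ℚ_[p])) m u else 0 with hν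
  set RS : ℕ → ℕ → ℚ_[p] := fun k n ↦
    ∑ᶠ ζ : rootsOfUnity (torsionOrder p) ℤ_[p], ∑ s : ZMod (p ^ n),
      ν (n + cyclotomicExponent p)
          (PadicInt.toZModPow (n + cyclotomicExponent p) ((ζ : ℤ_[p]ˣ) : ℤ_[p]) *
            (cyclotomicGenerator p : ZMod (p ^ (n + cyclotomicExponent p))) ^ s.val) *
        ((s.val.choose k : ℕ) : ℚ_[p]) with hRS
  have hw1 : ∀ u, ‖w u‖ ≤ 1 := norm_teichWeight_mul_psiWeight_le_one p i j hε1
  have hbdd : ∃ C : ℝ, ∀ (n : ℕ) (a : ZMod (p ^ n)), ‖ν n a‖ ≤ C := by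
    refine ⟨C₀, fun n a ↦ ?_⟩
    simp only [hν]
    split_ifs
    · exact norm_weightTwist_le hC₀ hw1 n a
    · rw [norm_zero]; exact hC00
  -- the Riemann sums of the truncated family agree with the twisted Riemann sums from level `j` on
  have hev : ∀ k, (RS k) =ᶠ[atTop] (padicLMinusBranchMultTwistRiemannSum f (ap : ℚ_[p]) i ε k) := by
    intro k
    refine eventually_atTop.2 ⟨j, fun n hn ↦ ?_⟩
    have hm : j + cyclotomicExponent p ≤ n + cyclotomicExponent p := Nat.add_le_add_right hn _
    rw [padicLMinusBranchMultTwistRiemannSum_eq f (ap : ℚ_[p]) hdist i hε k hn]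
    simp only [hRS, hν, if_pos hm]
    rfl
  have htend : ∀ k : ℕ, Tendsto (RS k) atTop
      (𝓝 (coeff k (padicLFunctionMinusBranchMultTwist f (ap : ℚ_[p]) i ε))) := fun k ↦ by
    rw [coeff_padicLFunctionMinusBranchMultTwist]
    exact (tendsto_padicLMinusBranchMultTwistRiemannSum f (ap : ℚ_[p]) hdist hC₀ i hε1 hε k).congr'
      (hev k).symm
  -- the symmetry of the truncated twisted family under `x ↦ -1/(Mx)`
  have hsym : ∀ (n : ℕ) (u u' : ZMod (p ^ (n + cyclotomicExponent p))),
      (M : ZMod (p ^ (n + cyclotomicExponent p))) * u * u' = -1 →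
        ν (n + cyclotomicExponent p) u =
          ((σ : ℚ_[p]) * (teichWeight p i (-(M : ZMod (p ^ cyclotomicExponent p))) *
              psiWeight p j ε (M : ZMod (p ^ (j + cyclotomicExponent p))))) *
            ν (n + cyclotomicExponent p) u' := by
    intro n u u' h
    by_cases hm : j + cyclotomicExponent p ≤ n + cyclotomicExponent p
    · have hL : 1 ≤ n + cyclotomicExponent p :=
        le_add_left (Nat.pos_of_ne_zero (cyclotomicExponent_ne_zero p))
      simp only [hν, if_pos hm]
      rw [weightTwist_apply_of_distribution hdist hm, weightTwist_apply_of_distribution hdist hm,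
        msdMinusMeasureMult_eq_mul_of_atkinLehner hNM hpM hσ hW (ap : ℚ_[p]) hL h]
      -- the relation at level `j + e₀`
      have h' : (M : ZMod (p ^ (j + cyclotomicExponent p))) *
          ZMod.castHom (pow_dvd_pow p hm) (ZMod (p ^ (j + cyclotomicExponent p))) u *
            ZMod.castHom (pow_dvd_pow p hm) (ZMod (p ^ (j + cyclotomicExponent p))) u' = -1 := by
        have := congrArg (ZMod.castHom (pow_dvd_pow p hm) (ZMod (p ^ (j + cyclotomicExponent p)))) h
        simpa only [map_mul, map_natCast, map_neg, map_one] using this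
      have key := teichWeight_mul_psiWeight_eq_mul p hi hε hε2 h'
      simp only [hw]
      rw [key, map_natCast]
      ring
    · simp only [hν, if_neg hm, mul_zero]
  exact subst_eq_of_measure_symmetry (μ := ν) (RS := RS) (fun _ _ ↦ rfl) hbdd htend hsym hc hι

/-- `ψ(⟨M⟩) = ε^{c mod p^j}` when `⟨M⟩ = γ^c` (`hc` at level `j`). [cite: MazurTateTeitelbaum1986Invent, §I.13] -/
theorem psiWeight_natCast_eq_of_exponent {M : ℕ} {ηM : rootsOfUnity (torsionOrder p) ℤ_[p]} {c : ℤ_[p]}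
    (hc : ∀ n : ℕ, PadicInt.toZModPow (n + cyclotomicExponent p) ((ηM : ℤ_[p]ˣ) : ℤ_[p]) *
        (cyclotomicGenerator p : ZMod (p ^ (n + cyclotomicExponent p))) ^ (PadicInt.toZModPow n c).val =
          (M : ZMod (p ^ (n + cyclotomicExponent p))))
    (j : ℕ) (ε : ℚ_[p]) :
    psiWeight p j ε (M : ZMod (p ^ (j + cyclotomicExponent p))) = ε ^ (PadicInt.toZModPow j c).val := by
  rw [← hc j, psiWeight_classMap]

/-- **The functional equation with the sign and the exponent PRODUCED**: for a rational newform `f` of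
level `N = pM`, `p ∤ M`, `a_p(f) = ±1`, a self-dual exponent `τ ∣ 2i` and a quadratic `ψ` (`ε^{p^j} = 1`,
`ε² = 1`), there are `w ∈ ℤ` with `w² = 1` and `c ∈ ℤ_p` such that
`L⁻_p(f, a_p, ω^i ψ, ι(T)) = w · (1 + T)^c · L⁻_p(f, a_p, ω^i ψ, T)` for every `ι` with `(1 + T)(1 + ι) = 1`
(`w = σ ω(−M)^i ψ(⟨M⟩)`: Knapp Thm. 9.27(b) `IsNewform0.exists_atkinLehnerInvolution_eq_smul`,
`exists_int_cast_eq_teichWeight`, `exists_int_cast_eq_psiWeight`; `⟨M⟩ = γ^c`: `exists_teichmuller_exponent_natCast`).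
[cite: MazurTateTeitelbaum1986Invent, §I.17] [cite: Knapp1993, Thm. 9.27(b)] -/
theorem exists_subst_padicLFunctionMinusBranchMultTwist_eq {M : ℕ}
    (hf : IsNewform0 f) (hQ : coeffField f = ⊥) (hNM : N = p * M) (hpM : ¬ p ∣ M)
    {ap : ℤ} (hap : cuspCoeff f p = ap) (hap1 : ap ^ 2 = 1) {i : ℕ} (hi : torsionOrder p ∣ 2 * i)
    {j : ℕ} {ε : ℚ_[p]} (hε : ε ^ p ^ j = 1) (hε2 : ε ^ 2 = 1) :
    ∃ w : ℤ, w ^ 2 = 1 ∧ ∃ c : ℤ_[p], ∀ {ι : ℚ_[p]⟦X⟧}, (1 + X : ℚ_[p]⟦X⟧) * (ι + 1) = 1 →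
      PowerSeries.subst ι (padicLFunctionMinusBranchMultTwist f (ap : ℚ_[p]) i ε) =
        C ((w : ℤ) : ℚ_[p]) * PowerSeries.binomialSeries ℚ_[p] c *
          padicLFunctionMinusBranchMultTwist f (ap : ℚ_[p]) i ε := by
  have hp : p.Prime := Fact.out
  have hM0 : M ≠ 0 := by rintro rfl; exact hpM (dvd_zero p)
  haveI : NeZero M := ⟨hM0⟩
  -- the Atkin–Lehner sign at `M`
  have hMN : M ∣ N := ⟨p, by rw [hNM, mul_comm]⟩
  have hcop : Nat.Coprime M (N / M) := by
    rw [hNM, mul_comm, Nat.mul_div_cancel_left p (Nat.pos_of_ne_zero hM0)]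
    exact ((Nat.Prime.coprime_iff_not_dvd hp).mpr hpM).symm
  obtain ⟨e, he, hWe⟩ := hf.exists_atkinLehnerInvolution_eq_smul (N := N) (k := (2 : ℤ)) hMN hcop
  obtain ⟨σ, hσ, hσe⟩ : ∃ σ : ℤ, σ ^ 2 = 1 ∧ (-(σ : ℂ)) = e := by
    rcases he with rfl | rfl
    · exact ⟨-1, by norm_num, by push_cast; ring⟩
    · exact ⟨1, by norm_num, by push_cast; ring⟩
  have hW : atkinLehnerInvolution N 2 M f = (-(σ : ℂ)) • f := by rw [hσe]; exact hWe
  -- the exponent of `⟨M⟩` and the integers `ω(-M)^i = ±1`, `ψ(⟨M⟩) = ±1`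
  obtain ⟨ηM, c, hc⟩ := exists_teichmuller_exponent_natCast p hpM
  have hcopj : ∀ m : ℕ, IsUnit (M : ZMod (p ^ m)) := fun m ↦ by
    rw [ZMod.isUnit_iff_coprime]
    exact Nat.Coprime.pow_right _ ((hp.coprime_iff_not_dvd).mpr hpM).symm
  obtain ⟨w₀, hw₀, hw₀'⟩ := exists_int_cast_eq_teichWeight p hi (hcopj (cyclotomicExponent p)).neg
  obtain ⟨w₁, hw₁, hw₁'⟩ := exists_int_cast_eq_psiWeight p (j := j) hε2 (hcopj (j + cyclotomicExponent p))
  refine ⟨σ * w₀ * w₁, by rw [mul_pow, mul_pow, hσ, hw₀, hw₁, mul_one, mul_one], c, fun {ι} hι ↦ ?_⟩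
  rw [subst_padicLFunctionMinusBranchMultTwist_eq_of_atkinLehner hf hQ hNM hpM hap hap1 hσ hW hc hi hε
    hε2 hι, ← hw₀', ← hw₁']
  push_cast
  ring_nf

end Main

end Literature.NumberTheory.EllipticCurves

end
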